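import Summits.MatrixMultiplication.MatrixMultiplication.Theorems.SoloInformedCyclotomicCharSums

/-!
# Cyclotomic translation schemes, II: the Jacobi-sum host bound (THEOREM C1)

Solo-informed seat (MatrixMultiplication), gen 103; dossier `paper/theoremB2.md` §6,
`sharpest-statement.md` §2y(9).

Let `F` be a finite field with `q` elements and `H ≤ Fˣ` a subgroup of order `m`. The CYCLOTOMIC
TRANSLATION SCHEME `Cyc(F, H)` is the translation scheme of the additive group of `F` with multiplier
group `H` acting by multiplication: its classes are `{0}` and the `[Fˣ : H]` cosets of `H` (rank
`[Fˣ : H] + 1`); they are labelled by any `c : F → Cl` with `c g = c h ↔ ∃ u ∈ H, u·g = h`. Classes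
`i, j, k` form a TRIANGLE (Cohn–Umans 2013, Def. 11; cf. `triangle_iff_twisted` in
`SoloInformedTranslationSchemes`) iff `∃ g h l` with labels `i, j, k` and `g + h + l = 0`, and `Cyc(F, H)`
REALIZES `⟨n,n,n⟩` (Def. 12) if maps `α β γ : [n]² → Cl` satisfy "`α x, β y, γ z` form a triangle
`⟺ y₁ = x₂ ∧ z = (y₂, x₁)`" (injectivity of the maps then follows and is not assumed).

* `sumfree_card_bound` — THEOREM C1 (i): if `A, B, C ⊆ Fˣ` are `H`-stable and `a + b + c ≠ 0` on
  `A × B × C`, then `(q-2)²·|A|·|B|·|C|·|H| ≤ q·(q-1)⁴` (for one coset each: the classical `|H| ≤ q^{3/4}`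
  threshold for the diagonal Fermat equation over `F`).
* `cyclotomicScheme_realization_bound` — THEOREM C1 (ii): if `Cyc(F, H)` realizes `⟨n,n,n⟩` then for
  every MM-free triple of index sets `I, J, K ⊆ [n]²` (no `x ∈ I, y ∈ J, z ∈ K` with `y₁ = x₂`,
  `z = (y₂, x₁)`): `(q-2)²·(|I|-1)(|J|-1)(|K|-1)·|H|⁴ ≤ q·(q-1)⁴` (truncated subtraction). With the
  MM-free half-boxes `{x₂ < n/2} × {y₁ ≥ n/2} × [n]²` this reads `|H|⁴ n⁶/4 ≲ q³`, i.e.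
  `q ≤ (4+o(1)) r⁴/n⁶` and `|H| ≤ (4+o(1)) r³/n⁶` for the number `r = [Fˣ : H]` of nonzero classes:
  a cyclotomic scheme of rank `n^{2+ε}` realizing `⟨n,n,n⟩` lives on a field of order `≤ 4n^{2+4ε}` with
  `≤ 4n^{3ε}` multipliers. Combined with Theorem B‴ (`translationScheme_exp_two_card_ge_behrend` etc.:
  `q ≥ n^{2/c_p - o(1)}` in characteristic `p`) this gives rank `≥ n^{3/2 + 1/(2c_p) - o(1)} > n^{2.04}`
  for `p = 2`: Conj. 21 of Cohn–Umans fails for cyclotomic schemes in bounded characteristic (dossier).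

Proof of (i): `main_identity` (file I) expresses `0 = (q-1)²·#solutions` as
`Σ_{χ₁,χ₂} conj B̂(χ₁)·conj Ĉ(χ₂)·Â(χ₁χ₂)·K(χ₁,χ₂)`; the principal pair contributes `|A||B||C|(q-2)`,
every other pair at most `|B̂||Ĉ||Â|·√q`; the transforms vanish off the annihilator of `H`
(`[Fˣ : H]` characters), and Cauchy–Schwarz plus Parseval finish. (ii): pull the index sets back to
the `H`-stable sets of units whose class lies in `α(I)`, `β(J)`, `γ(K)`; each used nonzero class is a
coset of size `|H|`, at most one index per map hits the class `{0}`, and a solution `a + b + c = 0` would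
be a triangle on an MM-free triple. References: Cohn–Umans 2013 (arXiv:1207.6528) Def. 11/12, Prop. 9/10,
Conj. 21, §6.2.
-/

noncomputable section

open Finset MulChar

namespace Summit.MatrixMultiplication.MatrixMultiplication.Theorems.Cyclotomic

variable {F : Type*} [Field F] [Fintype F] [DecidableEq F]

/-! ### 1. THEOREM C1 (i): sum-free `H`-stable triples are small -/

/-- **THEOREM C1 (i).** `F` a finite field with `q` elements, `H ≤ Fˣ`, and `A, B, C ⊆ Fˣ` with `B`
stable under multiplication by `H` and no solution of `a + b + c = 0`, `(a,b,c) ∈ A × B × C`. Then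
`(q-2)² · |A|·|B|·|C| · |H| ≤ q · (q-1)⁴` (only the stability of ONE of the three sets is used; by the
symmetry of the hypothesis any one will do). For `A = B = C` one coset of `H`: the classical
`|H| ≤ q^{3/4}` threshold for the diagonal Fermat equation over `F`. -/
theorem sumfree_card_bound (H : Subgroup Fˣ) (A B C : Finset Fˣ)
    (hB : ∀ u ∈ H, ∀ b ∈ B, u * b ∈ B)
    (hfree : ∀ a ∈ A, ∀ b ∈ B, ∀ c ∈ C, (a : F) + b + c ≠ 0) :
    ((Fintype.card F : ℝ) - 2) ^ 2 * (A.card * B.card * C.card) * Nat.card H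
      ≤ (Fintype.card F : ℝ) * ((Fintype.card F : ℝ) - 1) ^ 4 := by
  classical
  letI : Fintype (MulChar F ℂ) := Fintype.ofFinite _
  -- numerology
  have hq2 : (2 : ℝ) ≤ Fintype.card F := by exact_mod_cast Fintype.one_lt_card
  have hq1 : (0 : ℝ) ≤ (Fintype.card F : ℝ) - 1 := by linarith
  have hsq : 0 ≤ Real.sqrt (Fintype.card F) := Real.sqrt_nonneg _
  -- trivial case
  by_cases hABC : (A.card : ℝ) * B.card * C.card = 0
  · rw [hABC, mul_zero, zero_mul]; positivity
  have hpos : 0 < (A.card : ℝ) * B.card * C.card := lt_of_le_of_ne (by positivity) (Ne.symm hABC)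
  -- the expansion, as a sum over pairs
  set g : MulChar F ℂ × MulChar F ℂ → ℂ := fun p =>
    starRingEnd ℂ (ft B p.1) * starRingEnd ℂ (ft C p.2) * ft A (p.1 * p.2) * K p.1 p.2 with hg
  have hsum : ∑ p : MulChar F ℂ × MulChar F ℂ, g p = 0 := by
    rw [Fintype.sum_prod_type]; exact main_identity A B C hfree
  -- principal term
  have hg1 : g (1, 1) = (((B.card : ℝ) * C.card * A.card * ((Fintype.card F : ℝ) - 2) : ℝ) : ℂ) := by
    simp only [hg, one_mul, ft_one, map_natCast, K_one_one]
    push_cast; ring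
  have hnorm1 : ‖g (1, 1)‖ = (A.card : ℝ) * B.card * C.card * ((Fintype.card F : ℝ) - 2) := by
    rw [hg1, Complex.norm_of_nonneg] <;> nlinarith [hpos.le, hq2]
  have hprin : g (1, 1) = -∑ p ∈ (Finset.univ.erase ((1 : MulChar F ℂ), (1 : MulChar F ℂ))), g p := by
    rw [eq_neg_iff_add_eq_zero, Finset.add_sum_erase _ _ (Finset.mem_univ _), hsum]
  -- the real majorant
  set w : MulChar F ℂ × MulChar F ℂ → ℝ := fun p =>
    ‖ft B p.1‖ * ‖ft C p.2‖ * ‖ft A (p.1 * p.2)‖ with hw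
  have hw0 : ∀ p, 0 ≤ w p := fun p => by positivity
  have hstep1 : (A.card : ℝ) * B.card * C.card * ((Fintype.card F : ℝ) - 2)
      ≤ Real.sqrt (Fintype.card F) * ∑ χ₁ : MulChar F ℂ, ∑ χ₂ : MulChar F ℂ, w (χ₁, χ₂) := by
    rw [← hnorm1, hprin, norm_neg, ← Fintype.sum_prod_type, Finset.mul_sum]
    refine (norm_sum_le _ _).trans ?_
    refine (Finset.sum_le_sum fun p hp => ?_).trans
      (Finset.sum_le_sum_of_subset_of_nonneg (Finset.erase_subset _ _) fun p _ _ => by positivity)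
    have hp' : ¬ (p.1 = 1 ∧ p.2 = 1) := by
      intro h'; exact (Finset.ne_of_mem_erase hp) (Prod.ext h'.1 h'.2)
    rw [hg]
    simp only [norm_mul, Complex.norm_conj]
    rw [hw]
    calc ‖ft B p.1‖ * ‖ft C p.2‖ * ‖ft A (p.1 * p.2)‖ * ‖K p.1 p.2‖
        ≤ ‖ft B p.1‖ * ‖ft C p.2‖ * ‖ft A (p.1 * p.2)‖ * Real.sqrt (Fintype.card F) :=
          mul_le_mul_of_nonneg_left (norm_K_le hp') (by positivity)
      _ = _ := by ring
  -- inner Cauchy–Schwarz + Parseval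
  have hinner : ∀ χ₁ : MulChar F ℂ, ∑ χ₂ : MulChar F ℂ, ‖ft C χ₂‖ * ‖ft A (χ₁ * χ₂)‖
      ≤ Real.sqrt (((Fintype.card F : ℝ) - 1) * C.card) *
        Real.sqrt (((Fintype.card F : ℝ) - 1) * A.card) := by
    intro χ₁
    refine (Real.sum_mul_le_sqrt_mul_sqrt _ _ _).trans_eq ?_
    rw [sum_norm_ft_sq C]
    congr 2
    rw [← sum_norm_ft_sq A]
    exact Fintype.sum_bijective _ (Group.mulLeft_bijective χ₁) _ _ fun χ ↦ rfl
  -- support and outer Cauchy–Schwarz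
  set D := Finset.univ.filter (fun χ : MulChar F ℂ => ∀ u ∈ H, χ (u : F) = 1) with hD
  have hDm : (D.card : ℝ) * Nat.card H = (Fintype.card F : ℝ) - 1 := by
    have := card_annihilator_mul_card (F := F) H
    rw [← hD] at this
    have h1 : ((D.card * Nat.card H : ℕ) : ℝ) = ((Fintype.card F - 1 : ℕ) : ℝ) := by rw [this]
    push_cast [Nat.cast_sub one_le_card] at h1
    exact h1
  have houter : ∑ χ₁ : MulChar F ℂ, ‖ft B χ₁‖
      ≤ Real.sqrt (((Fintype.card F : ℝ) - 1) * B.card) * Real.sqrt D.card := by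
    have hsupp : ∑ χ₁ ∈ D, ‖ft B χ₁‖ * 1 = ∑ χ₁ : MulChar F ℂ, ‖ft B χ₁‖ := by
      simp_rw [mul_one]
      refine Finset.sum_filter_of_ne fun χ _ hχ => ?_
      by_contra hnot
      push Not at hnot
      obtain ⟨u, hu, hχu⟩ := hnot
      exact hχ (by rw [ft_eq_zero_of_apply_ne_one H B hB hu hχu, norm_zero])
    rw [← hsupp]
    refine (Real.sum_mul_le_sqrt_mul_sqrt _ _ _).trans ?_
    gcongr
    · calc ∑ i ∈ D, ‖ft B i‖ ^ 2 ≤ ∑ i : MulChar F ℂ, ‖ft B i‖ ^ 2 :=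
            Finset.sum_le_sum_of_subset_of_nonneg (Finset.filter_subset _ _)
              fun _ _ _ => by positivity
        _ = _ := sum_norm_ft_sq B
    · simp
  -- combine
  have hP : (A.card : ℝ) * B.card * C.card * ((Fintype.card F : ℝ) - 2)
      ≤ Real.sqrt (Fintype.card F) *
        ((Real.sqrt (((Fintype.card F : ℝ) - 1) * B.card) * Real.sqrt D.card) *
         (Real.sqrt (((Fintype.card F : ℝ) - 1) * C.card) *
          Real.sqrt (((Fintype.card F : ℝ) - 1) * A.card))) := by
    refine hstep1.trans (mul_le_mul_of_nonneg_left ?_ hsq)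
    calc ∑ χ₁ : MulChar F ℂ, ∑ χ₂ : MulChar F ℂ, w (χ₁, χ₂)
        = ∑ χ₁ : MulChar F ℂ, ‖ft B χ₁‖ * ∑ χ₂ : MulChar F ℂ, ‖ft C χ₂‖ * ‖ft A (χ₁ * χ₂)‖ := by
          refine Finset.sum_congr rfl fun χ₁ _ => ?_
          rw [Finset.mul_sum]
          exact Finset.sum_congr rfl fun χ₂ _ => by rw [hw]; ring
      _ ≤ ∑ χ₁ : MulChar F ℂ, ‖ft B χ₁‖ * (Real.sqrt (((Fintype.card F : ℝ) - 1) * C.card) *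
            Real.sqrt (((Fintype.card F : ℝ) - 1) * A.card)) :=
          Finset.sum_le_sum fun χ₁ _ => mul_le_mul_of_nonneg_left (hinner χ₁) (norm_nonneg _)
      _ = (∑ χ₁ : MulChar F ℂ, ‖ft B χ₁‖) * _ := by rw [Finset.sum_mul]
      _ ≤ _ := mul_le_mul_of_nonneg_right houter (by positivity)
  -- square
  have hP0 : 0 ≤ (A.card : ℝ) * B.card * C.card * ((Fintype.card F : ℝ) - 2) := by
    nlinarith [hpos.le, hq2]
  have hP2 := pow_le_pow_left₀ hP0 hP 2
  have hR2 : (Real.sqrt (Fintype.card F) *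
        ((Real.sqrt (((Fintype.card F : ℝ) - 1) * B.card) * Real.sqrt D.card) *
         (Real.sqrt (((Fintype.card F : ℝ) - 1) * C.card) *
          Real.sqrt (((Fintype.card F : ℝ) - 1) * A.card)))) ^ 2
      = (Fintype.card F : ℝ) * ((((Fintype.card F : ℝ) - 1) * B.card) * D.card) *
         ((((Fintype.card F : ℝ) - 1) * C.card) * (((Fintype.card F : ℝ) - 1) * A.card)) := by
    simp only [mul_pow, Real.sq_sqrt (Nat.cast_nonneg _),
      Real.sq_sqrt (mul_nonneg hq1 (Nat.cast_nonneg _))]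
    ring
  rw [hR2] at hP2
  -- multiply by |H| and cancel |A||B||C|
  have hm0 : (0 : ℝ) ≤ Nat.card H := Nat.cast_nonneg _
  have key : ((Fintype.card F : ℝ) - 2) ^ 2 * (A.card * B.card * C.card) * Nat.card H *
      ((A.card : ℝ) * B.card * C.card)
      ≤ (Fintype.card F : ℝ) * ((Fintype.card F : ℝ) - 1) ^ 4 * ((A.card : ℝ) * B.card * C.card) := by
    have := mul_le_mul_of_nonneg_right hP2 hm0
    calc ((Fintype.card F : ℝ) - 2) ^ 2 * (A.card * B.card * C.card) * Nat.card H *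
          ((A.card : ℝ) * B.card * C.card)
          = ((A.card : ℝ) * B.card * C.card * ((Fintype.card F : ℝ) - 2)) ^ 2 * Nat.card H := by ring
      _ ≤ _ := this
      _ = (Fintype.card F : ℝ) * ((Fintype.card F : ℝ) - 1) ^ 3 * ((A.card : ℝ) * B.card * C.card) *
            ((D.card : ℝ) * Nat.card H) := by ring
      _ = _ := by rw [hDm]; ring
  exact le_of_mul_le_mul_right key hpos

/-! ### 2. From a realization of `⟨n,n,n⟩` to sum-free `H`-stable triples -/

omit [Fintype F] [DecidableEq F] in
/-- The units whose class lies in `α(I)` form an `H`-stable set. -/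
theorem stable_of_classes (H : Subgroup Fˣ) {Cl : Type*} (c : F → Cl)
    (hc : ∀ g h : F, c g = c h ↔ ∃ u ∈ H, (u : F) * g = h)
    {ι : Type*} (I : Finset ι) (α : ι → Cl)
    (A : Finset Fˣ) (hA : ∀ a : Fˣ, a ∈ A ↔ ∃ x ∈ I, c (a : F) = α x) :
    ∀ u ∈ H, ∀ a ∈ A, u * a ∈ A := by
  intro u hu a ha
  obtain ⟨x, hx, hxa⟩ := (hA a).mp ha
  refine (hA (u * a)).mpr ⟨x, hx, ?_⟩
  rw [← hxa, eq_comm, hc]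
  exact ⟨u, hu, by rw [Units.val_mul]⟩

/-- If `α` is injective on `I` and every class `α x` is represented, the units whose class lies in
`α(I)` number at least `(|I| - 1)·|H|`: each represented nonzero class is an `H`-coset, and at most one
index maps to the class of `0`. -/
theorem card_mul_le_of_classes (H : Subgroup Fˣ) {Cl : Type*} (c : F → Cl)
    (hc : ∀ g h : F, c g = c h ↔ ∃ u ∈ H, (u : F) * g = h)
    {ι : Type*} (I : Finset ι) (α : ι → Cl) (hinj : ∀ x ∈ I, ∀ x' ∈ I, α x = α x' → x = x')
    (hrep : ∀ x ∈ I, ∃ g : F, c g = α x)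
    (A : Finset Fˣ) (hA : ∀ a : Fˣ, a ∈ A ↔ ∃ x ∈ I, c (a : F) = α x) :
    ((I.card - 1 : ℕ) : ℝ) * Nat.card H ≤ A.card := by
  classical
  -- indices whose class is not the class of `0`
  set I' := I.filter (fun x => α x ≠ c 0) with hI'
  have hI'card : I.card - 1 ≤ I'.card := by
    have h1 : (I.filter (fun x => α x = c 0)).card ≤ 1 := by
      refine Finset.card_le_one.mpr fun x hx x' hx' => ?_
      rw [Finset.mem_filter] at hx hx'
      exact hinj x hx.1 x' hx'.1 (hx.2.trans hx'.2.symm)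
    have h2 := Finset.card_filter_add_card_filter_not (s := I) (fun x => α x = c 0)
    have h3 : I.card ≤ 1 + I'.card := by rw [← h2, hI']; exact Nat.add_le_add_right h1 _
    omega
  -- the fibres over I' are `H`-cosets, pairwise disjoint, inside `A`
  set fib : ι → Finset Fˣ := fun x => Finset.univ.filter (fun a : Fˣ => c (a : F) = α x) with hfib
  have hHcard : ∀ x ∈ I', Nat.card H ≤ (fib x).card := by
    intro x hx
    rw [Finset.mem_filter] at hx
    obtain ⟨g, hg⟩ := hrep x hx.1
    have hg0 : g ≠ 0 := by rintro rfl; exact hx.2 hg.symm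
    set HF := Finset.univ.filter (fun u : Fˣ => u ∈ H) with hHF
    have hHF' : HF.card = Nat.card H := by
      rw [hHF, ← Fintype.card_subtype, Nat.card_eq_fintype_card]
    rw [← hHF']
    refine Finset.card_le_card_of_injOn (fun u => u * Units.mk0 g hg0) ?_ ?_
    · intro u hu
      rw [Finset.mem_coe, Finset.mem_filter] at hu
      rw [Finset.mem_coe, hfib, Finset.mem_filter]
      refine ⟨Finset.mem_univ _, ?_⟩
      rw [← hg, eq_comm, hc]
      exact ⟨u, hu.2, by rw [Units.val_mul, Units.val_mk0]⟩
    · intro u _ u' _ h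
      exact mul_right_cancel h
  have hdisj : ∀ x ∈ I', ∀ x' ∈ I', x ≠ x' → Disjoint (fib x) (fib x') := by
    intro x hx x' hx' hne
    rw [Finset.disjoint_left]
    intro a ha ha'
    rw [hfib, Finset.mem_filter] at ha ha'
    exact hne (hinj x (Finset.mem_filter.mp hx).1 x' (Finset.mem_filter.mp hx').1
      (ha.2.symm.trans ha'.2))
  have hsub : I'.biUnion fib ⊆ A := by
    intro a ha
    rw [Finset.mem_biUnion] at ha
    obtain ⟨x, hx, hax⟩ := ha
    rw [hfib, Finset.mem_filter] at hax
    exact (hA a).mpr ⟨x, (Finset.mem_filter.mp hx).1, hax.2⟩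
  have hcard : I'.card * Nat.card H ≤ A.card := by
    calc I'.card * Nat.card H = ∑ x ∈ I', Nat.card H := by rw [Finset.sum_const, smul_eq_mul]
      _ ≤ ∑ x ∈ I', (fib x).card := Finset.sum_le_sum hHcard
      _ = (I'.biUnion fib).card := (Finset.card_biUnion hdisj).symm
      _ ≤ A.card := Finset.card_le_card hsub
  calc ((I.card - 1 : ℕ) : ℝ) * Nat.card H ≤ (I'.card : ℝ) * Nat.card H :=
        mul_le_mul_of_nonneg_right (by exact_mod_cast hI'card) (Nat.cast_nonneg _)
    _ ≤ A.card := by exact_mod_cast hcard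

/-! ### 3. THEOREM C1 (ii): the realization bound -/

/-- **THEOREM C1 (ii).** If the cyclotomic translation scheme `Cyc(F, H)` realizes `⟨n,n,n⟩` in the sense
of Cohn–Umans 2013, Def. 12 (labels `c` of the `H`-orbits on `F`, maps `α β γ`, triangle iff
matrix-multiplication support), then for every MM-free triple of index sets `I, J, K`,
`(q-2)²·(|I|-1)(|J|-1)(|K|-1)·|H|⁴ ≤ q·(q-1)⁴`. [CU13 Def. 11/12; this file] -/
theorem cyclotomicScheme_realization_bound (H : Subgroup Fˣ) {Cl : Type*} (c : F → Cl)
    (hc : ∀ g h : F, c g = c h ↔ ∃ u ∈ H, (u : F) * g = h)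
    {n : ℕ} (α β γ : Fin n × Fin n → Cl)
    (hreal : ∀ x y z : Fin n × Fin n,
      (∃ g h l : F, c g = α x ∧ c h = β y ∧ c l = γ z ∧ g + h + l = 0) ↔
        (y.1 = x.2 ∧ z = (y.2, x.1)))
    (I J K : Finset (Fin n × Fin n))
    (hfree : ∀ x ∈ I, ∀ y ∈ J, ∀ z ∈ K, ¬ (y.1 = x.2 ∧ z = (y.2, x.1))) :
    ((Fintype.card F : ℝ) - 2) ^ 2 *
        (((I.card - 1 : ℕ) : ℝ) * ((J.card - 1 : ℕ) : ℝ) * ((K.card - 1 : ℕ) : ℝ)) *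
        (Nat.card H : ℝ) ^ 4 ≤ (Fintype.card F : ℝ) * ((Fintype.card F : ℝ) - 1) ^ 4 := by
  classical
  -- every class is represented; the maps are injective
  have hrepα : ∀ x ∈ I, ∃ g : F, c g = α x := by
    intro x _
    obtain ⟨g, h, l, hg, -, -, -⟩ := (hreal x (x.2, x.1) (x.1, x.1)).mpr ⟨rfl, rfl⟩
    exact ⟨g, hg⟩
  have hrepβ : ∀ y ∈ J, ∃ g : F, c g = β y := by
    intro y _
    obtain ⟨g, h, l, -, hh, -, -⟩ := (hreal (y.1, y.1) y (y.2, y.1)).mpr ⟨rfl, rfl⟩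
    exact ⟨h, hh⟩
  have hrepγ : ∀ z ∈ K, ∃ g : F, c g = γ z := by
    intro z _
    obtain ⟨g, h, l, -, -, hl, -⟩ := (hreal (z.2, z.2) (z.2, z.1) z).mpr ⟨rfl, by simp⟩
    exact ⟨l, hl⟩
  have hinjα : ∀ x ∈ I, ∀ x' ∈ I, α x = α x' → x = x' := by
    intro x _ x' _ hxx
    obtain ⟨g, h, l, hg, hh, hl, hs⟩ := (hreal x (x.2, x.1) (x.1, x.1)).mpr ⟨rfl, rfl⟩
    obtain ⟨h1, h2⟩ := (hreal x' (x.2, x.1) (x.1, x.1)).mp ⟨g, h, l, hg.trans hxx, hh, hl, hs⟩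
    exact Prod.ext (by simpa using (Prod.ext_iff.mp h2).2) (by simpa using h1)
  have hinjβ : ∀ y ∈ J, ∀ y' ∈ J, β y = β y' → y = y' := by
    intro y _ y' _ hyy
    obtain ⟨g, h, l, hg, hh, hl, hs⟩ := (hreal (y.1, y.1) y (y.2, y.1)).mpr ⟨rfl, rfl⟩
    obtain ⟨h1, h2⟩ := (hreal (y.1, y.1) y' (y.2, y.1)).mp ⟨g, h, l, hg, hh.trans hyy, hl, hs⟩
    exact Prod.ext h1.symm (by simpa using (Prod.ext_iff.mp h2).1)
  have hinjγ : ∀ z ∈ K, ∀ z' ∈ K, γ z = γ z' → z = z' := by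
    intro z _ z' _ hzz
    obtain ⟨g, h, l, hg, hh, hl, hs⟩ := (hreal (z.2, z.2) (z.2, z.1) z).mpr ⟨rfl, by simp⟩
    obtain ⟨-, h2⟩ := (hreal (z.2, z.2) (z.2, z.1) z').mp ⟨g, h, l, hg, hh, hl.trans hzz, hs⟩
    rw [h2]
  -- the pulled-back sets of units
  set A := Finset.univ.filter (fun a : Fˣ => ∃ x ∈ I, c (a : F) = α x) with hAdef
  set B := Finset.univ.filter (fun a : Fˣ => ∃ y ∈ J, c (a : F) = β y) with hBdef
  set C := Finset.univ.filter (fun a : Fˣ => ∃ z ∈ K, c (a : F) = γ z) with hCdef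
  have hA : ∀ a : Fˣ, a ∈ A ↔ ∃ x ∈ I, c (a : F) = α x := fun a => by simp [hAdef]
  have hB : ∀ a : Fˣ, a ∈ B ↔ ∃ y ∈ J, c (a : F) = β y := fun a => by simp [hBdef]
  have hC : ∀ a : Fˣ, a ∈ C ↔ ∃ z ∈ K, c (a : F) = γ z := fun a => by simp [hCdef]
  have hfree' : ∀ a ∈ A, ∀ b ∈ B, ∀ d ∈ C, (a : F) + b + d ≠ 0 := by
    intro a ha b hb d hd hsum
    obtain ⟨x, hx, hxa⟩ := (hA a).mp ha
    obtain ⟨y, hy, hyb⟩ := (hB b).mp hb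
    obtain ⟨z, hz, hzd⟩ := (hC d).mp hd
    exact hfree x hx y hy z hz ((hreal x y z).mp ⟨a, b, d, hxa, hyb, hzd, hsum⟩)
  have hmain := sumfree_card_bound H A B C (stable_of_classes H c hc J β B hB) hfree'
  have hIA := card_mul_le_of_classes H c hc I α hinjα hrepα A hA
  have hJB := card_mul_le_of_classes H c hc J β hinjβ hrepβ B hB
  have hKC := card_mul_le_of_classes H c hc K γ hinjγ hrepγ C hC
  have hm : (0 : ℝ) ≤ Nat.card H := Nat.cast_nonneg _
  calc ((Fintype.card F : ℝ) - 2) ^ 2 *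
        (((I.card - 1 : ℕ) : ℝ) * ((J.card - 1 : ℕ) : ℝ) * ((K.card - 1 : ℕ) : ℝ)) *
        (Nat.card H : ℝ) ^ 4
        = ((Fintype.card F : ℝ) - 2) ^ 2 * ((((I.card - 1 : ℕ) : ℝ) * Nat.card H) *
            (((J.card - 1 : ℕ) : ℝ) * Nat.card H) * (((K.card - 1 : ℕ) : ℝ) * Nat.card H)) *
            Nat.card H := by ring
    _ ≤ ((Fintype.card F : ℝ) - 2) ^ 2 * ((A.card : ℝ) * B.card * C.card) * Nat.card H := by
        gcongr
    _ ≤ _ := hmain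

end Summit.MatrixMultiplication.MatrixMultiplication.Theorems.Cyclotomic
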